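import Mathlib
import Summits.Ventures.PercRepro2.RowC1DetHFresh

/-!
# Conditional positive association of two `a₂`-connections given `a₁ ↮ X`
(blind cell PercRepro2, p2 g31; proofs/P2-G31-DETH.md §2, §5(b))

For any avoidance set `X ∋ a₂` and any two vertices `v, w`, with `R_X = {a₁ ↮ x for all x ∈ X}`,

  `P(R_X, v ↔ a₂)·P(R_X, w ↔ a₂) ≤ P(R_X, v ↔ a₂, w ↔ a₂)·P(R_X)`

(`condPA_conn_a₂`): conditionally on `a₁ ↮ X`, the events `{v ↔ a₂}` and `{w ↔ a₂}` are positively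
correlated.  `X = {a₂}` is BHK06 Theorem 1.1; `X = {a₂, b, o}`, `v = b`, `w = o` is the H-determinant
of row 2′C1 (`RowC1DetH.lean`, `detH_nonneg`, whose proof this lemma abstracts); the other members of
the cell's family of sign-determined conditional covariances follow in the same way.

Proof: explore the cluster `K = C(a₁)`; on `R_X` the cluster of `a₂` is its cluster in the fresh graph
`G ∖ K`, so `P(R_X, v ↔ a₂) = E[f_v(K) 1_{R_X}]` with `f_v(K) = P_{G∖K}(v ↔ a₂)` (`freshH`), and Harris in
`G ∖ K` gives `P(R_X, v ↔ a₂, w ↔ a₂) ≥ E[f_v f_w 1_{R_X}]`; the functional BHK inequality `bhk_induced`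
for the cluster of `a₁` with the avoidance set `X` and the monotone functionals `1 − f_v`, `1 − f_w`
gives `E[f_v 1_R]·E[f_w 1_R] ≤ E[f_v f_w 1_R]·P(R)`.  Std axioms.
-/

namespace Summit.Ventures.PercRepro2

namespace RowC1

section CondPA

open Classical

variable {V : Type*} {E : Type*} [Fintype E] [DecidableEq E] [Fintype V] [DecidableEq V]
  {R : Type*} [CommRing R] [LinearOrder R] [IsStrictOrderedRing R]

/-- The family `{K : K ∩ X = ∅}` of clusters avoiding `X`. -/
def avoidFamX (X : Finset V) : Set (Set V) := {K : Set V | ∀ x ∈ X, x ∉ K}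

omit [Fintype E] [DecidableEq E] [DecidableEq V] [LinearOrder R] [IsStrictOrderedRing R] in
/-- `R^{univ}_X = {C(a₁) avoids X}` (as events). -/
lemma REvent_eq_clusterInEvent (ends : E → Sym2 V) (a₁ : V) (X : Finset V) :
    REvent ends Finset.univ a₁ X = clusterInEvent ends a₁ (avoidFamX X) := by
  ext ω
  simp only [REvent, Finset.coe_univ, induced_univ, Set.mem_setOf_eq, mem_clusterInEvent,
    avoidFamX, mem_cluster]

omit [Fintype E] [DecidableEq E] [DecidableEq V] [LinearOrder R] [IsStrictOrderedRing R] in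
/-- With `a₂ ∈ X`, `R_X ∩ {v ↔ a₂} ∩ {w ↔ a₂}` as an exploration event. -/
lemma ev_vw (ends : E → Sym2 V) (a₁ a₂ v w : V) (X : Finset V) (ha₂ : a₂ ∈ X) :
    REvent ends Finset.univ a₁ X ∩ connEvent ends a₂ v ∩ connEvent ends a₂ w =
      clusterInEvent ends a₁ (avoidFamX X) ∩
        clusterInEvent ends a₂ {C : Set V | v ∈ C ∧ w ∈ C} ∩ (connEvent ends a₁ a₂)ᶜ := by
  rw [REvent_eq_clusterInEvent]
  ext ω
  constructor
  · rintro ⟨⟨hR, hv⟩, hw⟩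
    exact ⟨⟨hR, ⟨hv, hw⟩⟩, fun h => hR a₂ ha₂ h⟩
  · rintro ⟨⟨hR, ⟨hv, hw⟩⟩, -⟩
    exact ⟨⟨hR, hv⟩, hw⟩

omit [Fintype E] [DecidableEq E] [DecidableEq V] [LinearOrder R] [IsStrictOrderedRing R] in
/-- With `a₂ ∈ X`, `R_X ∩ {v ↔ a₂}` as an exploration event. -/
lemma ev_v (ends : E → Sym2 V) (a₁ a₂ v : V) (X : Finset V) (ha₂ : a₂ ∈ X) :
    REvent ends Finset.univ a₁ X ∩ connEvent ends a₂ v =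
      clusterInEvent ends a₁ (avoidFamX X) ∩
        clusterInEvent ends a₂ {C : Set V | v ∈ C} ∩ (connEvent ends a₁ a₂)ᶜ := by
  rw [REvent_eq_clusterInEvent]
  ext ω
  constructor
  · rintro ⟨hR, hv⟩
    exact ⟨⟨hR, hv⟩, fun h => hR a₂ ha₂ h⟩
  · rintro ⟨⟨hR, hv⟩, -⟩
    exact ⟨hR, hv⟩

omit [Fintype E] [DecidableEq E] [DecidableEq V] [LinearOrder R] [IsStrictOrderedRing R] in
/-- With `a₂ ∈ X`, `R_X` as an exploration event (`𝓥 = univ`). -/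
lemma ev_R (ends : E → Sym2 V) (a₁ a₂ : V) (X : Finset V) (ha₂ : a₂ ∈ X) :
    REvent ends Finset.univ a₁ X =
      clusterInEvent ends a₁ (avoidFamX X) ∩
        clusterInEvent ends a₂ (Set.univ : Set (Set V)) ∩ (connEvent ends a₁ a₂)ᶜ := by
  rw [REvent_eq_clusterInEvent]
  ext ω
  constructor
  · intro hR
    exact ⟨⟨hR, Set.mem_univ _⟩, fun h => hR a₂ ha₂ h⟩
  · rintro ⟨⟨hR, -⟩, -⟩
    exact hR

omit [Fintype V] [DecidableEq V] [LinearOrder R] [IsStrictOrderedRing R] in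
/-- The fresh probability of the full family is `1`. -/
lemma delClusterProb_univ (p : E → R) (ends : E → Sym2 V) (a₂ : V) (K : Set V) :
    delClusterProb p ends a₂ (Set.univ : Set (Set V)) K = 1 := by
  unfold delClusterProb
  have : ({ω : Config E | cluster ends (delConfig ends K ω) a₂ ∈ (Set.univ : Set (Set V))}) =
      Set.univ := by
    ext ω; simp
  rw [this, prob_univ]

omit [Fintype V] [DecidableEq V] [LinearOrder R] [IsStrictOrderedRing R] in
/-- `delClusterProb` of a singleton-membership family is `freshH`. -/
lemma delClusterProb_mem (p : E → R) (ends : E → Sym2 V) (a₂ v : V) (K : Set V) :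
    delClusterProb p ends a₂ {C : Set V | v ∈ C} K = freshH p ends a₂ v K := rfl

/-- The avoidance indicator `1[C(a₁) avoids X]·1_Q`. -/
noncomputable def avoidIndX (ends : E → Sym2 V) (a₁ a₂ : V) (X : Finset V) (ω : Config E) : R :=
  (avoidFamX X).indicator 1 (cluster ends ω a₁) * ((connEvent ends a₁ a₂)ᶜ).indicator 1 ω

omit [Fintype E] [DecidableEq E] [Fintype V] [DecidableEq V] in
/-- `0 ≤ I_X`. -/
lemma avoidIndX_nonneg (ends : E → Sym2 V) (a₁ a₂ : V) (X : Finset V) (ω : Config E) :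
    (0 : R) ≤ avoidIndX ends a₁ a₂ X ω :=
  mul_nonneg (Set.indicator_apply_nonneg fun _ => zero_le_one)
    (Set.indicator_apply_nonneg fun _ => zero_le_one)

omit [Fintype E] [DecidableEq E] [DecidableEq V] [LinearOrder R] [IsStrictOrderedRing R] in
/-- With `a₂ ∈ X`, `I_X` is the indicator of `R_X`. -/
lemma REvent_indicator_eq_avoidIndX (ends : E → Sym2 V) (a₁ a₂ : V) (X : Finset V) (ha₂ : a₂ ∈ X)
    (ω : Config E) :
    (REvent ends Finset.univ a₁ X).indicator (1 : Config E → R) ω = avoidIndX ends a₁ a₂ X ω := by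
  unfold avoidIndX
  rw [REvent_eq_clusterInEvent]
  by_cases h : ω ∈ clusterInEvent ends a₁ (avoidFamX X)
  · have hQ : ω ∈ (connEvent ends a₁ a₂)ᶜ := fun hc => h a₂ ha₂ hc
    rw [Set.indicator_of_mem h, Set.indicator_of_mem (show cluster ends ω a₁ ∈ avoidFamX X from h),
      Set.indicator_of_mem hQ]
    simp
  · rw [Set.indicator_of_notMem h,
      Set.indicator_of_notMem (show cluster ends ω a₁ ∉ avoidFamX X from h), zero_mul]

/-- **The BHK step with avoidance set `X`**: `E[f_v I_X]·E[f_w I_X] ≤ E[f_v f_w I_X]·E[I_X]`. -/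
theorem bhk_avoidX_step (p : E → R) (hp : IsProbVec p) (ends : E → Sym2 V) (a₁ a₂ v w : V)
    (X : Finset V) (ha₂ : a₂ ∈ X) :
    expect p (fun ω => freshH p ends a₂ v (cluster ends ω a₁) * avoidIndX ends a₁ a₂ X ω) *
        expect p (fun ω => freshH p ends a₂ w (cluster ends ω a₁) * avoidIndX ends a₁ a₂ X ω) ≤
      expect p (fun ω => freshH p ends a₂ v (cluster ends ω a₁) *
          freshH p ends a₂ w (cluster ends ω a₁) * avoidIndX ends a₁ a₂ X ω) *
        expect p (fun ω => avoidIndX ends a₁ a₂ X ω) := by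
  have hF₁ : Monotone (fun K : Set V => 1 - freshH p ends a₂ v K) :=
    fun K K' h => sub_le_sub_left (freshH_anti p hp ends a₂ v h) 1
  have hF₂ : Monotone (fun K : Set V => 1 - freshH p ends a₂ w K) :=
    fun K K' h => sub_le_sub_left (freshH_anti p hp ends a₂ w h) 1
  have hF₁0 : ∀ K : Set V, 0 ≤ 1 - freshH p ends a₂ v K :=
    fun K => sub_nonneg.2 (freshH_le_one p hp ends a₂ v K)
  have hF₂0 : ∀ K : Set V, 0 ≤ 1 - freshH p ends a₂ w K :=
    fun K => sub_nonneg.2 (freshH_le_one p hp ends a₂ w K)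
  have h := bhk_induced p hp ends a₁ hF₁ hF₂ hF₁0 hF₂0 Finset.univ X X
    (Finset.subset_univ _) (Finset.subset_univ _)
  simp only [Finset.inter_self, Finset.union_self] at h
  have e1 : ∀ F : Set V → R, clusterObs ends Finset.univ a₁ F *
      (REvent ends Finset.univ a₁ X).indicator 1 =
      fun ω => F (cluster ends ω a₁) * avoidIndX ends a₁ a₂ X ω := by
    intro F
    funext ω
    simp only [Pi.mul_apply, clusterObs_apply, clusterIn_univ,
      REvent_indicator_eq_avoidIndX ends a₁ a₂ X ha₂]
  have e2 : prob p (REvent ends Finset.univ a₁ X) =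
      expect p (fun ω => avoidIndX ends a₁ a₂ X ω) := by
    rw [prob_eq_expect_indicator]
    unfold expect
    refine Finset.sum_congr rfl fun ω _ => ?_
    rw [REvent_indicator_eq_avoidIndX ends a₁ a₂ X ha₂]
  rw [e1, e1, e1, e2] at h
  simp only [Pi.mul_apply] at h
  have ef : expect p (fun ω => (1 - freshH p ends a₂ v (cluster ends ω a₁)) *
      avoidIndX ends a₁ a₂ X ω) = expect p (fun ω => avoidIndX ends a₁ a₂ X ω) -
      expect p (fun ω => freshH p ends a₂ v (cluster ends ω a₁) * avoidIndX ends a₁ a₂ X ω) :=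
    expect_one_sub_mul p _ _
  have eg : expect p (fun ω => (1 - freshH p ends a₂ w (cluster ends ω a₁)) *
      avoidIndX ends a₁ a₂ X ω) = expect p (fun ω => avoidIndX ends a₁ a₂ X ω) -
      expect p (fun ω => freshH p ends a₂ w (cluster ends ω a₁) * avoidIndX ends a₁ a₂ X ω) :=
    expect_one_sub_mul p _ _
  have efg : expect p (fun ω => (1 - freshH p ends a₂ v (cluster ends ω a₁)) *
      (1 - freshH p ends a₂ w (cluster ends ω a₁)) * avoidIndX ends a₁ a₂ X ω) =
      expect p (fun ω => avoidIndX ends a₁ a₂ X ω) -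
      expect p (fun ω => freshH p ends a₂ v (cluster ends ω a₁) * avoidIndX ends a₁ a₂ X ω) -
      expect p (fun ω => freshH p ends a₂ w (cluster ends ω a₁) * avoidIndX ends a₁ a₂ X ω) +
      expect p (fun ω => freshH p ends a₂ v (cluster ends ω a₁) *
        freshH p ends a₂ w (cluster ends ω a₁) * avoidIndX ends a₁ a₂ X ω) :=
    expect_one_sub_mul_one_sub_mul p _ _ _
  rw [ef, eg, efg] at h
  nlinarith [h]

/-- **Conditional positive association of two `a₂`-connections given `a₁ ↮ X`** (`a₂ ∈ X`):
`P(R_X, v ↔ a₂)·P(R_X, w ↔ a₂) ≤ P(R_X, v ↔ a₂, w ↔ a₂)·P(R_X)`, `R_X = {a₁ ↮ x, x ∈ X}`.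
`X = {a₂}` is BHK06 1.1; `X = {a₂, b, o}` is the H-determinant of row 2′C1. -/
theorem condPA_conn_a₂ (p : E → R) (hp : IsProbVec p) (ends : E → Sym2 V) (a₁ a₂ v w : V)
    (X : Finset V) (ha₂ : a₂ ∈ X) :
    prob p (REvent ends Finset.univ a₁ X ∩ connEvent ends a₂ v) *
        prob p (REvent ends Finset.univ a₁ X ∩ connEvent ends a₂ w) ≤
      prob p (REvent ends Finset.univ a₁ X ∩ connEvent ends a₂ v ∩ connEvent ends a₂ w) *
        prob p (REvent ends Finset.univ a₁ X) := by
  rw [ev_vw ends a₁ a₂ v w X ha₂, ev_v ends a₁ a₂ v X ha₂, ev_v ends a₁ a₂ w X ha₂,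
    ev_R ends a₁ a₂ X ha₂, prob_clusterIn_inter_eq_expect, prob_clusterIn_inter_eq_expect,
    prob_clusterIn_inter_eq_expect, prob_clusterIn_inter_eq_expect]
  simp only [delClusterProb_mem, delClusterProb_univ p, mul_one]
  have hI0 : ∀ ω, (0 : R) ≤ (avoidFamX X).indicator 1 (cluster ends ω a₁) *
      ((connEvent ends a₁ a₂)ᶜ).indicator 1 ω := fun ω => avoidIndX_nonneg ends a₁ a₂ X ω
  -- the exact identities `E[1_𝓤 f 1_Q] = E[f I]` and the Harris bound for the joint term
  have ev' : expect p (fun ω => (avoidFamX X).indicator 1 (cluster ends ω a₁) *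
      freshH p ends a₂ v (cluster ends ω a₁) * ((connEvent ends a₁ a₂)ᶜ).indicator 1 ω) =
      expect p (fun ω => freshH p ends a₂ v (cluster ends ω a₁) * avoidIndX ends a₁ a₂ X ω) :=
    congrArg (expect p) (funext fun ω => by unfold avoidIndX; ring)
  have ew' : expect p (fun ω => (avoidFamX X).indicator 1 (cluster ends ω a₁) *
      freshH p ends a₂ w (cluster ends ω a₁) * ((connEvent ends a₁ a₂)ᶜ).indicator 1 ω) =
      expect p (fun ω => freshH p ends a₂ w (cluster ends ω a₁) * avoidIndX ends a₁ a₂ X ω) :=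
    congrArg (expect p) (funext fun ω => by unfold avoidIndX; ring)
  have eR : expect p (fun ω => (avoidFamX X).indicator 1 (cluster ends ω a₁) *
      ((connEvent ends a₁ a₂)ᶜ).indicator 1 ω) = expect p (fun ω => avoidIndX ends a₁ a₂ X ω) :=
    congrArg (expect p) (funext fun ω => by unfold avoidIndX; ring)
  have hA : expect p (fun ω => freshH p ends a₂ v (cluster ends ω a₁) *
        freshH p ends a₂ w (cluster ends ω a₁) * avoidIndX ends a₁ a₂ X ω) ≤
      expect p (fun ω => (avoidFamX X).indicator 1 (cluster ends ω a₁) *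
        delClusterProb p ends a₂ {C : Set V | v ∈ C ∧ w ∈ C} (cluster ends ω a₁) *
        ((connEvent ends a₁ a₂)ᶜ).indicator 1 ω) := by
    refine expect_mono hp fun ω => ?_
    have h1 := fresh_both_ge p hp ends a₂ w v (cluster ends ω a₁)
    unfold avoidIndX
    nlinarith [mul_le_mul_of_nonneg_right h1 (hI0 ω)]
  rw [ev', ew', eR]
  have key := bhk_avoidX_step p hp ends a₁ a₂ v w X ha₂
  have nI : 0 ≤ expect p (fun ω => avoidIndX ends a₁ a₂ X ω) :=
    expect_nonneg hp fun ω => avoidIndX_nonneg ends a₁ a₂ X ω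
  calc _ ≤ _ := key
    _ ≤ _ := mul_le_mul_of_nonneg_right hA nI


omit [Fintype E] [DecidableEq E] [DecidableEq V] [LinearOrder R] [IsStrictOrderedRing R] in
/-- With `a₂ ∈ X`, `R_X ∩ {v ↔ a₂} ∩ {w ↮ a₂}` as an exploration event. -/
lemma ev_v_nw (ends : E → Sym2 V) (a₁ a₂ v w : V) (X : Finset V) (ha₂ : a₂ ∈ X) :
    REvent ends Finset.univ a₁ X ∩ connEvent ends a₂ v ∩ (connEvent ends a₂ w)ᶜ =
      clusterInEvent ends a₁ (avoidFamX X) ∩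
        clusterInEvent ends a₂ {C : Set V | v ∈ C ∧ w ∉ C} ∩ (connEvent ends a₁ a₂)ᶜ := by
  rw [REvent_eq_clusterInEvent]
  ext ω
  constructor
  · rintro ⟨⟨hR, hv⟩, hw⟩
    exact ⟨⟨hR, ⟨hv, hw⟩⟩, fun h => hR a₂ ha₂ h⟩
  · rintro ⟨⟨hR, ⟨hv, hw⟩⟩, -⟩
    exact ⟨⟨hR, hv⟩, hw⟩

omit [Fintype E] [DecidableEq E] [DecidableEq V] [LinearOrder R] [IsStrictOrderedRing R] in
/-- With `a₂ ∈ X`, `R_X ∩ {w ↮ a₂}` as an exploration event. -/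
lemma ev_nw (ends : E → Sym2 V) (a₁ a₂ w : V) (X : Finset V) (ha₂ : a₂ ∈ X) :
    REvent ends Finset.univ a₁ X ∩ (connEvent ends a₂ w)ᶜ =
      clusterInEvent ends a₁ (avoidFamX X) ∩
        clusterInEvent ends a₂ {C : Set V | w ∉ C} ∩ (connEvent ends a₁ a₂)ᶜ := by
  rw [REvent_eq_clusterInEvent]
  ext ω
  constructor
  · rintro ⟨hR, hw⟩
    exact ⟨⟨hR, hw⟩, fun h => hR a₂ ha₂ h⟩
  · rintro ⟨⟨hR, hw⟩, -⟩
    exact ⟨hR, hw⟩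

omit [Fintype E] [DecidableEq E] [DecidableEq V] [LinearOrder R] [IsStrictOrderedRing R] in
/-- With `a₂ ∈ X`, `R_X ∩ {v ↮ a₂} ∩ {w ↮ a₂}` as an exploration event. -/
lemma ev_nv_nw (ends : E → Sym2 V) (a₁ a₂ v w : V) (X : Finset V) (ha₂ : a₂ ∈ X) :
    REvent ends Finset.univ a₁ X ∩ (connEvent ends a₂ v)ᶜ ∩ (connEvent ends a₂ w)ᶜ =
      clusterInEvent ends a₁ (avoidFamX X) ∩
        clusterInEvent ends a₂ {C : Set V | v ∉ C ∧ w ∉ C} ∩ (connEvent ends a₁ a₂)ᶜ := by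
  rw [REvent_eq_clusterInEvent]
  ext ω
  constructor
  · rintro ⟨⟨hR, hv⟩, hw⟩
    exact ⟨⟨hR, ⟨hv, hw⟩⟩, fun h => hR a₂ ha₂ h⟩
  · rintro ⟨⟨hR, ⟨hv, hw⟩⟩, -⟩
    exact ⟨⟨hR, hv⟩, hw⟩

omit [Fintype V] [DecidableEq V] [LinearOrder R] [IsStrictOrderedRing R] in
/-- `P_{G∖K}(w ∉ C(a₂)) = 1 − f_w(K)`. -/
lemma delClusterProb_notMem (p : E → R) (ends : E → Sym2 V) (a₂ w : V) (K : Set V) :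
    delClusterProb p ends a₂ {C : Set V | w ∉ C} K = 1 - freshH p ends a₂ w K := by
  unfold delClusterProb
  have e : ({ω : Config E | cluster ends (delConfig ends K ω) a₂ ∈ {C : Set V | w ∉ C}}) =
      (freshEv ends a₂ w K)ᶜ := by
    ext ω; exact Iff.rfl
  rw [e, prob_compl, freshH_eq_prob]

/-- **Conditional negative correlation of `{v ↔ a₂}` and `{w ↮ a₂}` given `a₁ ↮ X`** (`a₂ ∈ X`):
`P(R_X, v ↔ a₂, w ↮ a₂)·P(R_X) ≤ P(R_X, v ↔ a₂)·P(R_X, w ↮ a₂)`. -/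
theorem condNA_conn_a₂ (p : E → R) (hp : IsProbVec p) (ends : E → Sym2 V) (a₁ a₂ v w : V)
    (X : Finset V) (ha₂ : a₂ ∈ X) :
    prob p (REvent ends Finset.univ a₁ X ∩ connEvent ends a₂ v ∩ (connEvent ends a₂ w)ᶜ) *
        prob p (REvent ends Finset.univ a₁ X) ≤
      prob p (REvent ends Finset.univ a₁ X ∩ connEvent ends a₂ v) *
        prob p (REvent ends Finset.univ a₁ X ∩ (connEvent ends a₂ w)ᶜ) := by
  rw [ev_v_nw ends a₁ a₂ v w X ha₂, ev_v ends a₁ a₂ v X ha₂, ev_nw ends a₁ a₂ w X ha₂,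
    ev_R ends a₁ a₂ X ha₂, prob_clusterIn_inter_eq_expect, prob_clusterIn_inter_eq_expect,
    prob_clusterIn_inter_eq_expect, prob_clusterIn_inter_eq_expect]
  simp only [delClusterProb_mem, delClusterProb_univ p, delClusterProb_notMem, mul_one]
  have hI0 : ∀ ω, (0 : R) ≤ (avoidFamX X).indicator 1 (cluster ends ω a₁) *
      ((connEvent ends a₁ a₂)ᶜ).indicator 1 ω := fun ω => avoidIndX_nonneg ends a₁ a₂ X ω
  have ev' : expect p (fun ω => (avoidFamX X).indicator 1 (cluster ends ω a₁) *
      freshH p ends a₂ v (cluster ends ω a₁) * ((connEvent ends a₁ a₂)ᶜ).indicator 1 ω) =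
      expect p (fun ω => freshH p ends a₂ v (cluster ends ω a₁) * avoidIndX ends a₁ a₂ X ω) :=
    congrArg (expect p) (funext fun ω => by unfold avoidIndX; ring)
  have enw' : expect p (fun ω => (avoidFamX X).indicator 1 (cluster ends ω a₁) *
      (1 - freshH p ends a₂ w (cluster ends ω a₁)) * ((connEvent ends a₁ a₂)ᶜ).indicator 1 ω) =
      expect p (fun ω => (1 - freshH p ends a₂ w (cluster ends ω a₁)) * avoidIndX ends a₁ a₂ X ω) :=
    congrArg (expect p) (funext fun ω => by unfold avoidIndX; ring)
  have eR : expect p (fun ω => (avoidFamX X).indicator 1 (cluster ends ω a₁) *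
      ((connEvent ends a₁ a₂)ᶜ).indicator 1 ω) = expect p (fun ω => avoidIndX ends a₁ a₂ X ω) :=
    congrArg (expect p) (funext fun ω => by unfold avoidIndX; ring)
  -- Harris in `G ∖ K` for the joint term (upper bound)
  have hB : expect p (fun ω => (avoidFamX X).indicator 1 (cluster ends ω a₁) *
        delClusterProb p ends a₂ {C : Set V | v ∈ C ∧ w ∉ C} (cluster ends ω a₁) *
        ((connEvent ends a₁ a₂)ᶜ).indicator 1 ω) ≤
      expect p (fun ω => freshH p ends a₂ v (cluster ends ω a₁) *
        (1 - freshH p ends a₂ w (cluster ends ω a₁)) * avoidIndX ends a₁ a₂ X ω) := by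
    refine expect_mono hp fun ω => ?_
    have h1 := fresh_b_in_o_out_le p hp ends a₂ w v (cluster ends ω a₁)
    unfold avoidIndX
    nlinarith [mul_le_mul_of_nonneg_right h1 (hI0 ω)]
  rw [ev', enw', eR]
  -- the BHK step for `f_v` and `1 − f_w`: `E[f_v (1 − f_w) I]·E[I] ≤ E[f_v I]·E[(1 − f_w) I]`
  have key := bhk_avoidX_step p hp ends a₁ a₂ v w X ha₂
  have ew := expect_one_sub_mul p (fun ω => freshH p ends a₂ w (cluster ends ω a₁))
    (fun ω => avoidIndX ends a₁ a₂ X ω)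
  have evw := expect_mul_one_sub_mul p (fun ω => freshH p ends a₂ v (cluster ends ω a₁))
    (fun ω => freshH p ends a₂ w (cluster ends ω a₁)) (fun ω => avoidIndX ends a₁ a₂ X ω)
  have nI : 0 ≤ expect p (fun ω => avoidIndX ends a₁ a₂ X ω) :=
    expect_nonneg hp fun ω => avoidIndX_nonneg ends a₁ a₂ X ω
  have hBI := mul_le_mul_of_nonneg_right hB nI
  rw [evw] at hBI
  rw [ew]
  nlinarith [hBI, key]

/-- **Conditional positive association of `{v ↮ a₂}` and `{w ↮ a₂}` given `a₁ ↮ X`** (`a₂ ∈ X`):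
`P(R_X, v ↮ a₂)·P(R_X, w ↮ a₂) ≤ P(R_X, v ↮ a₂, w ↮ a₂)·P(R_X)`. -/
theorem condPA_nconn_a₂ (p : E → R) (hp : IsProbVec p) (ends : E → Sym2 V) (a₁ a₂ v w : V)
    (X : Finset V) (ha₂ : a₂ ∈ X) :
    prob p (REvent ends Finset.univ a₁ X ∩ (connEvent ends a₂ v)ᶜ) *
        prob p (REvent ends Finset.univ a₁ X ∩ (connEvent ends a₂ w)ᶜ) ≤
      prob p (REvent ends Finset.univ a₁ X ∩ (connEvent ends a₂ v)ᶜ ∩ (connEvent ends a₂ w)ᶜ) *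
        prob p (REvent ends Finset.univ a₁ X) := by
  rw [ev_nv_nw ends a₁ a₂ v w X ha₂, ev_nw ends a₁ a₂ v X ha₂, ev_nw ends a₁ a₂ w X ha₂,
    ev_R ends a₁ a₂ X ha₂, prob_clusterIn_inter_eq_expect, prob_clusterIn_inter_eq_expect,
    prob_clusterIn_inter_eq_expect, prob_clusterIn_inter_eq_expect]
  simp only [delClusterProb_univ p, delClusterProb_notMem, mul_one]
  have hI0 : ∀ ω, (0 : R) ≤ (avoidFamX X).indicator 1 (cluster ends ω a₁) *
      ((connEvent ends a₁ a₂)ᶜ).indicator 1 ω := fun ω => avoidIndX_nonneg ends a₁ a₂ X ω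
  have env' : expect p (fun ω => (avoidFamX X).indicator 1 (cluster ends ω a₁) *
      (1 - freshH p ends a₂ v (cluster ends ω a₁)) * ((connEvent ends a₁ a₂)ᶜ).indicator 1 ω) =
      expect p (fun ω => (1 - freshH p ends a₂ v (cluster ends ω a₁)) * avoidIndX ends a₁ a₂ X ω) :=
    congrArg (expect p) (funext fun ω => by unfold avoidIndX; ring)
  have enw' : expect p (fun ω => (avoidFamX X).indicator 1 (cluster ends ω a₁) *
      (1 - freshH p ends a₂ w (cluster ends ω a₁)) * ((connEvent ends a₁ a₂)ᶜ).indicator 1 ω) =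
      expect p (fun ω => (1 - freshH p ends a₂ w (cluster ends ω a₁)) * avoidIndX ends a₁ a₂ X ω) :=
    congrArg (expect p) (funext fun ω => by unfold avoidIndX; ring)
  have eR : expect p (fun ω => (avoidFamX X).indicator 1 (cluster ends ω a₁) *
      ((connEvent ends a₁ a₂)ᶜ).indicator 1 ω) = expect p (fun ω => avoidIndX ends a₁ a₂ X ω) :=
    congrArg (expect p) (funext fun ω => by unfold avoidIndX; ring)
  have hD : expect p (fun ω => (1 - freshH p ends a₂ v (cluster ends ω a₁)) *
        (1 - freshH p ends a₂ w (cluster ends ω a₁)) * avoidIndX ends a₁ a₂ X ω) ≤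
      expect p (fun ω => (avoidFamX X).indicator 1 (cluster ends ω a₁) *
        delClusterProb p ends a₂ {C : Set V | v ∉ C ∧ w ∉ C} (cluster ends ω a₁) *
        ((connEvent ends a₁ a₂)ᶜ).indicator 1 ω) := by
    refine expect_mono hp fun ω => ?_
    have h1 := fresh_neither_ge p hp ends a₂ w v (cluster ends ω a₁)
    unfold avoidIndX
    nlinarith [mul_le_mul_of_nonneg_right h1 (hI0 ω)]
  rw [env', enw', eR]
  have key := bhk_avoidX_step p hp ends a₁ a₂ v w X ha₂
  have ev := expect_one_sub_mul p (fun ω => freshH p ends a₂ v (cluster ends ω a₁))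
    (fun ω => avoidIndX ends a₁ a₂ X ω)
  have ew := expect_one_sub_mul p (fun ω => freshH p ends a₂ w (cluster ends ω a₁))
    (fun ω => avoidIndX ends a₁ a₂ X ω)
  have evw := expect_one_sub_mul_one_sub_mul p (fun ω => freshH p ends a₂ v (cluster ends ω a₁))
    (fun ω => freshH p ends a₂ w (cluster ends ω a₁)) (fun ω => avoidIndX ends a₁ a₂ X ω)
  have nI : 0 ≤ expect p (fun ω => avoidIndX ends a₁ a₂ X ω) :=
    expect_nonneg hp fun ω => avoidIndX_nonneg ends a₁ a₂ X ω
  have hDI := mul_le_mul_of_nonneg_right hD nI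
  rw [evw] at hDI
  rw [ev, ew]
  nlinarith [hDI, key]

end CondPA

end RowC1

end Summit.Ventures.PercRepro2
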